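import Summits.Langlands.Langlands.Theorems.PhantomRMYoshidaResiduallyYoshidaLiftingSplit
import HarnessLib

/-!
# Route `PhantomRMYoshida`, crux `ResiduallyYoshidaLifting` (stmt-Langlands-13639), line `sector-klingen-split`,
# skeleton rev 5: the four reshaped open stubs measured against the route target

Lead prover-line-stmt-Langlands-13639-c3-0 (2026-08-17), after wave 1.  Skeleton rev 5 reshapes the anchor / propagation
stubs R1c, R1d to their KLINGEN-family forms R1c-K `stub_selmerAnchorKlingen` / R1d-K `stub_nonsplitPropagationKlingen`
(anchor = an automorphic point of Klingen shape `(0,0,c,c)`, `c ≡ 1 mod p-1`; wave-1 verdict on R1d: a regular-weight anchor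
names the Borel engine whose Skinner–Wiles output is a REGULAR limit, exceeding the target by the disprover's T8) and cuts the
corner stub into `stub_cornerThree` (`p = 3`) and `stub_cornerTwist` (`p ≥ 5`, twist pair), composed through the landed
vacuity theorem p146293.  This file records, kernel-checked, that each of the four carries NO risk beyond the route's own target
`PhantomRMSector` (registered sub-goals `stub_selmerAnchorKlingen_of_target`, `stub_nonsplitPropagationKlingen_of_target`,
`stub_cornerThree_of_target`, `stub_cornerTwist_of_target`): under the target the irreducible `Sh`-point at hand is
automorphic (oddness from `DetC`, `isOdd_of_detC`), it is its own Klingen-shape realiser with `c = 1` and its own Klingen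
approximant (`klingenDensityGeneric_of_phantomRMSector`, `everyShIsKlingenLimit_of_phantomRMSector`, p137929 / p116982).
Nothing is asserted: the target enters only as a hypothesis.
-/

noncomputable section

-- `Summit.Langlands.Langlands.…` (summit = sub-problem name, D-0017 layout) trips `dupNamespace` on every decl.
set_option linter.dupNamespace false
set_option autoImplicit false

open IsDedekindDomain Filter
open Literature.NumberTheory.GaloisRepresentations Literature.NumberTheory.Automorphic
open Summit.Langlands.Langlands.Cruxes.ResiduallyYoshidaLifting.YoshidaDivisorSelmerCount
open Summit.Langlands.Langlands.Cruxes.ResiduallyYoshidaLifting.SectorSplit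

namespace Summit.Langlands.Langlands.Cruxes.ResiduallyYoshidaLifting.SectorKlingenSplit

/-- **R1c-K ≤ route target** (registered sub-goal `stub_selmerAnchorKlingen_of_target`): under `PhantomRMSector` the
realising irreducible `Sh`-point `ρ` of the hypothesis is automorphic and is itself the Klingen-shape witness with `c = 1`
(shape `(0,0,1,1)` = the `Sh` Greenberg clause), the `Sh` multiplier, and the same realisation triple. -/
theorem stub_selmerAnchorKlingen_of_target :
    Summit.Langlands.Langlands.Theses.PhantomRMYoshida.PhantomRMSector → (∀ (p : ℕ) [Fact p.Prime], p ≠ 2 →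
    ∀ (k : Type) [Field k] [CharP k p] [IsAlgClosed k]
    [TopologicalSpace k] [DiscreteTopology k] (red : Valued.integer (PadicAlgCl p) →+* k)
    (σ σ' : FramedGaloisRep ℚ k 2) (hcpt : isCompact_glFiniteIntegralLevel 4 ℚ) (ι : PadicAlgCl p ≃+* ℂ)
    (B : Field.absoluteGaloisGroup ℚ → Matrix (Fin 2) (Fin 2) k),
    σ.toGaloisRep.IsIrreducible → σ'.toGaloisRep.IsIrreducible → DetC p k σ σ' →
    (¬ ∃ g : GL (Fin 2) k, ∀ x, g * σ x * g⁻¹ = σ' x) → GenericSector p k σ σ' →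
    (¬ ∃ X : Matrix (Fin 2) (Fin 2) k, ∀ g, B g = (σ g).val * X - X * (σ' g).val) →
    (∃ ρ : FramedGaloisRep ℚ (PadicAlgCl p) 4, ρ.toGaloisRep.IsIrreducible ∧ Sh p k red σ σ' ρ ∧
      ∃ (P : GL (Fin 4) (PadicAlgCl p))
        (rint : Field.absoluteGaloisGroup ℚ →* GL (Fin 4) (Valued.integer (PadicAlgCl p))) (h : GL (Fin 4) k),
        (∀ g, Matrix.GeneralLinearGroup.map (Valued.integer (PadicAlgCl p)).subtype (rint g) = P⁻¹ * ρ g * P) ∧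
        (∀ g, (Matrix.GeneralLinearGroup.map red (rint g)).val =
          h.val * Matrix.reindex finSumFinEquiv finSumFinEquiv
            (Matrix.fromBlocks (σ g).val (B g) 0 (σ' g).val) * (h⁻¹).val)) →
    ∃ ρ₁ : FramedGaloisRep ℚ (PadicAlgCl p) 4, ρ₁.toGaloisRep.IsIrreducible ∧ Aut p hcpt ι ρ₁ ∧
      (∃ c : ℕ, (c : ZMod (p - 1)) = 1 ∧
        (∃ ν : Field.absoluteGaloisGroup ℚ → PadicAlgCl p, ρ₁.IsSymplecticWithMultiplierFun ν) ∧
        ∀ v : HeightOneSpectrum (NumberField.RingOfIntegers ℚ), ((p : ℕ) : NumberField.RingOfIntegers ℚ) ∈ v.asIdeal →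
          ρ₁.IsGreenbergOrdinaryOfShapeAt v ![0, 0, c, c] ∧ ρ₁.IsResiduallyDistinguishedAt v ![0, 0, c, c]) ∧
      ∃ (P : GL (Fin 4) (PadicAlgCl p))
        (rint : Field.absoluteGaloisGroup ℚ →* GL (Fin 4) (Valued.integer (PadicAlgCl p))) (h : GL (Fin 4) k),
        (∀ g, Matrix.GeneralLinearGroup.map (Valued.integer (PadicAlgCl p)).subtype (rint g) = P⁻¹ * ρ₁ g * P) ∧
        (∀ g, (Matrix.GeneralLinearGroup.map red (rint g)).val =
          h.val * Matrix.reindex finSumFinEquiv finSumFinEquiv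
            (Matrix.fromBlocks (σ g).val (B g) 0 (σ' g).val) * (h⁻¹).val)) := by
  intro hT p _ hp k _ _ _ _ _ red σ σ' hcpt ι B hσ hσ' hdet hnc _hG _hncB hreal
  obtain ⟨ρ, hρ, hSh, P, rint, h, hfr, hred⟩ := hreal
  have hAut : Aut p hcpt ι ρ :=
    hT p hp k red σ σ' hcpt ι ρ (isOdd_of_detC hdet).1 (isOdd_of_detC hdet).2 hσ hσ' hdet hnc hρ hSh
  refine ⟨ρ, hρ, hAut, ⟨1, by simp, ⟨_, hSh.1⟩, fun v hv => hSh.2.1 v hv⟩, P, rint, h, hfr, hred⟩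

/-- **R1d-K ≤ route target** (registered sub-goal `stub_nonsplitPropagationKlingen_of_target`): under `PhantomRMSector` the
irreducible `Sh`-point `ρ` is its own Klingen approximant (`klingenDensityGeneric_of_phantomRMSector`); the class `B`, its
realisation and the Klingen-shape anchor are not consumed. -/
theorem stub_nonsplitPropagationKlingen_of_target :
    Summit.Langlands.Langlands.Theses.PhantomRMYoshida.PhantomRMSector → (∀ (p : ℕ) [Fact p.Prime], p ≠ 2 →
    ∀ (k : Type) [Field k] [CharP k p] [IsAlgClosed k]
    [TopologicalSpace k] [DiscreteTopology k] (red : Valued.integer (PadicAlgCl p) →+* k)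
    (σ σ' : FramedGaloisRep ℚ k 2) (hcpt : isCompact_glFiniteIntegralLevel 4 ℚ) (ι : PadicAlgCl p ≃+* ℂ)
    (ρ : FramedGaloisRep ℚ (PadicAlgCl p) 4) (B : Field.absoluteGaloisGroup ℚ → Matrix (Fin 2) (Fin 2) k),
    σ.toGaloisRep.IsIrreducible → σ'.toGaloisRep.IsIrreducible → DetC p k σ σ' →
    (¬ ∃ g : GL (Fin 2) k, ∀ x, g * σ x * g⁻¹ = σ' x) → GenericSector p k σ σ' →
    (¬ ∃ X : Matrix (Fin 2) (Fin 2) k, ∀ g, B g = (σ g).val * X - X * (σ' g).val) →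
    ρ.toGaloisRep.IsIrreducible → Sh p k red σ σ' ρ →
    (∃ (P : GL (Fin 4) (PadicAlgCl p))
        (rint : Field.absoluteGaloisGroup ℚ →* GL (Fin 4) (Valued.integer (PadicAlgCl p))) (h : GL (Fin 4) k),
        (∀ g, Matrix.GeneralLinearGroup.map (Valued.integer (PadicAlgCl p)).subtype (rint g) = P⁻¹ * ρ g * P) ∧
        (∀ g, (Matrix.GeneralLinearGroup.map red (rint g)).val =
          h.val * Matrix.reindex finSumFinEquiv finSumFinEquiv
            (Matrix.fromBlocks (σ g).val (B g) 0 (σ' g).val) * (h⁻¹).val)) →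
    (∃ ρ₁ : FramedGaloisRep ℚ (PadicAlgCl p) 4, ρ₁.toGaloisRep.IsIrreducible ∧ Aut p hcpt ι ρ₁ ∧
      (∃ c : ℕ, (c : ZMod (p - 1)) = 1 ∧
        (∃ ν : Field.absoluteGaloisGroup ℚ → PadicAlgCl p, ρ₁.IsSymplecticWithMultiplierFun ν) ∧
        ∀ v : HeightOneSpectrum (NumberField.RingOfIntegers ℚ), ((p : ℕ) : NumberField.RingOfIntegers ℚ) ∈ v.asIdeal →
          ρ₁.IsGreenbergOrdinaryOfShapeAt v ![0, 0, c, c] ∧ ρ₁.IsResiduallyDistinguishedAt v ![0, 0, c, c]) ∧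
      ∃ (P : GL (Fin 4) (PadicAlgCl p))
        (rint : Field.absoluteGaloisGroup ℚ →* GL (Fin 4) (Valued.integer (PadicAlgCl p))) (h : GL (Fin 4) k),
        (∀ g, Matrix.GeneralLinearGroup.map (Valued.integer (PadicAlgCl p)).subtype (rint g) = P⁻¹ * ρ₁ g * P) ∧
        (∀ g, (Matrix.GeneralLinearGroup.map red (rint g)).val =
          h.val * Matrix.reindex finSumFinEquiv finSumFinEquiv
            (Matrix.fromBlocks (σ g).val (B g) 0 (σ' g).val) * (h⁻¹).val)) →
    IsKlingenClassicalLimit p hcpt ι ρ) := by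
  intro hT p _ hp k _ _ _ _ _ red σ σ' hcpt ι ρ B hσ hσ' hdet hnc hG _hncB hρ hSh _hreal _hanchor
  exact klingenDensityGeneric_of_phantomRMSector hT p hp k red σ σ' hcpt ι ρ hσ hσ' hdet hnc hG hρ hSh

/-- **corner-3 ≤ route target** (registered sub-goal `stub_cornerThree_of_target`): under `PhantomRMSector` every
irreducible `Sh`-point is its own Klingen approximant (`everyShIsKlingenLimit_of_phantomRMSector`); `p = 3 ≠ 2`. -/
theorem stub_cornerThree_of_target :
    Summit.Langlands.Langlands.Theses.PhantomRMYoshida.PhantomRMSector → (∀ (p : ℕ) [Fact p.Prime], p = 3 →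
    ∀ (k : Type) [Field k] [CharP k p] [IsAlgClosed k]
    [TopologicalSpace k] [DiscreteTopology k] (red : Valued.integer (PadicAlgCl p) →+* k)
    (σ σ' : FramedGaloisRep ℚ k 2) (hcpt : isCompact_glFiniteIntegralLevel 4 ℚ) (ι : PadicAlgCl p ≃+* ℂ)
    (ρ : FramedGaloisRep ℚ (PadicAlgCl p) 4),
    σ.toGaloisRep.IsIrreducible → σ'.toGaloisRep.IsIrreducible → DetC p k σ σ' →
    (¬ ∃ g : GL (Fin 2) k, ∀ x, g * σ x * g⁻¹ = σ' x) →
    ρ.toGaloisRep.IsIrreducible → Sh p k red σ σ' ρ → IsKlingenClassicalLimit p hcpt ι ρ) := by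
  intro hT p _ hp3 k _ _ _ _ _ red σ σ' hcpt ι ρ hσ hσ' hdet hnc hρ hSh
  have hp : p ≠ 2 := by omega
  exact everyShIsKlingenLimit_of_phantomRMSector hT p hp k red σ σ' hcpt ι ρ hσ hσ' hdet hnc hρ hSh

/-- **corner-twist ≤ route target** (registered sub-goal `stub_cornerTwist_of_target`): as above; `5 ≤ p` gives `p ≠ 2`
and the twist-pair hypothesis is not consumed. -/
theorem stub_cornerTwist_of_target :
    Summit.Langlands.Langlands.Theses.PhantomRMYoshida.PhantomRMSector → (∀ (p : ℕ) [Fact p.Prime], 5 ≤ p →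
    ∀ (k : Type) [Field k] [CharP k p] [IsAlgClosed k]
    [TopologicalSpace k] [DiscreteTopology k] (red : Valued.integer (PadicAlgCl p) →+* k)
    (σ σ' : FramedGaloisRep ℚ k 2) (hcpt : isCompact_glFiniteIntegralLevel 4 ℚ) (ι : PadicAlgCl p ≃+* ℂ)
    (ρ : FramedGaloisRep ℚ (PadicAlgCl p) 4),
    σ.toGaloisRep.IsIrreducible → σ'.toGaloisRep.IsIrreducible → DetC p k σ σ' →
    (¬ ∃ g : GL (Fin 2) k, ∀ x, g * σ x * g⁻¹ = σ' x) →
    (∃ g : GL (Fin 2) k, ∀ x, ∃ c : k, (g * σ x * g⁻¹).val = c • (σ' x).val) →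
    ρ.toGaloisRep.IsIrreducible → Sh p k red σ σ' ρ → IsKlingenClassicalLimit p hcpt ι ρ) := by
  intro hT p _ hp5 k _ _ _ _ _ red σ σ' hcpt ι ρ hσ hσ' hdet hnc _htw hρ hSh
  have hp : p ≠ 2 := by omega
  exact everyShIsKlingenLimit_of_phantomRMSector hT p hp k red σ σ' hcpt ι ρ hσ hσ' hdet hnc hρ hSh

end Summit.Langlands.Langlands.Cruxes.ResiduallyYoshidaLifting.SectorKlingenSplit

end
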